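/-
Copyright (c) 2026 the pub-hodgecm-mathlib formalisation cell (harness21).  Prover seat hodgecm-mathlib-K2E3-p17 (g8), Track B «K2-LIT» ∕ h413
(`stmt-HodgeConjecture-24833`), line `K2_E3_EllipticInputs`, leaf (nsc-S-A′) `sig_K2E3GL3PrincipalBlockStandardSpan`, H-layer tool brick EMB of the architect's
`MEMO-SA-architecture.v2.K2E3-p25-g2.md` §1 (architect K2E3-p25 (g2); dealer K2E3-plan (g4) D86).  2026-09-04.
-/
import Summits.HodgeConjecture.HodgeConjecture.Theorems.K2E3JacquetExponentEigenvector     -- ★ E1b `exists_functional_of_weightSpace_ne_bot` (+ ★ E1a)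
import Summits.HodgeConjecture.HodgeConjecture.Theorems.K2E3GLnPrincipalBlockEmbedding    -- ★ `levi_id_mul_comm`
import Literature.NumberTheory.Automorphic.ParabolicInductionProofs                       -- ★ `frobenius_reciprocity_gl_holds`
import Mathlib.RepresentationTheory.Irreducible
import HarnessLib

/-!
# Crux `H413` — leaf (nsc-S-A′), H-layer tool EMB: A NON-ZERO WEIGHT `χ` OF `r_B ρ` EMBEDS `ρ` INTO THE PRINCIPAL SERIES `I(χ)` (and conversely)

Cell `hodgecm-mathlib`, Track B; THEOREMS ONLY; count-neutral helper (`--supports stmt-HodgeConjecture-24833 --as helper`).  Currency (CONVENTIONS 08:40Z, MEMO v2 §0):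
torus `LB N := Π a : Fin N, GL {i // (id : Fin N → Fin N) i = a} F`, `r_B ρ := (restrictUnipotentGL F id ρ).Coinvariants` with `normalizedJacquetGL F id ρ`,
`mult ρ η := finrank ℂ ↥(⨅ m, maxGenEigenspace (normalizedJacquetGL F id ρ m) (η m))` (inline), `I(χ) := parabolicIndGL F id ((trivial ℂ (LB N) ℂ).twist χ)` for a character
`χ : LB N →* ℂˣ` (the H-layer's `I θ` is `I (tch θ)`).

* §1 (generic commutative-action linear algebra, complement to ★ E1b): a non-zero functional `l` with `l ∘ τ(m) = χ(m) l` forces the `χ`-weight space to be non-zero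
  (`weightSpace_ne_bot_of_functional`: `l` kills every other weight space by `l((τ m − c)^k v) = (χ m − c)^k l v`, and the weight spaces span ★ E1a).
* §2 **`exists_intertwiningMap_parabolicIndGL_ne_zero`**: `ρ` smooth, `r_B ρ` finite-dimensional, `mult ρ ⇑χ ≠ 0 ⇒ ∃ Φ : ρ → I(χ), Φ ≠ 0` (★ E1b functional + ★ Frobenius
  `frobenius_reciprocity_gl_holds`); **`exists_injective_intertwiningMap_parabolicIndGL`** (`ρ` irreducible ⇒ `Φ` injective, Schur); the CONVERSE
  **`finrank_weightSpace_ne_zero_of_intertwiningMap_ne_zero`** (`Φ ≠ 0 ⇒ mult ρ ⇑χ ≠ 0`) and the `iff`.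

HONEST LABEL: HC_CM is proved only modulo the 7 printed citations (2 remaining named inputs: hLiu418 = stmt-HodgeConjecture-24832, h413 =
stmt-HodgeConjecture-24833) until rung 0 closes; count-neutral helper.

## References
* [BernsteinZelevinsky1977] I. N. Bernstein, A. V. Zelevinsky, *Induced representations of reductive p-adic groups I*, Ann. Sci. ÉNS 10 (1977), Prop. 1.9 (b), Thm. 2.5, §2.3.
* [Casselman1995] W. Casselman, *Introduction to the theory of admissible representations of p-adic reductive groups* (draft 1995), Thm. 3.2.4, §6.3.
-/

set_option autoImplicit false
-- the mandated namespace repeats `HodgeConjecture.HodgeConjecture`, as in every `Theorems/*.lean` of this sub-problem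
set_option linter.dupNamespace false

noncomputable section

open Representation Module Function Literature.NumberTheory.Automorphic Literature.NumberTheory.GaloisRepresentations.IsNonarchimedeanLocalField
open scoped MatrixGroups
open Summit.HodgeConjecture.HodgeConjecture.Cruxes.H413.K2E3JacquetExponentMultiset
open Summit.HodgeConjecture.HodgeConjecture.Cruxes.H413.K2E3JacquetExponentEigenvector
open Summit.HodgeConjecture.HodgeConjecture.Cruxes.H413.K2E3GLnPrincipalBlockEmbedding

namespace Summit.HodgeConjecture.HodgeConjecture.Cruxes.H413.K2E3GL3EmbeddingOfWeight

/-! ## §1 A `χ`-equivariant non-zero functional detects the `χ`-weight space -/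

section Functional

variable {M : Type*} [Group M] {W : Type*} [AddCommGroup W] [Module ℂ W] (τ : Representation ℂ M W)

/-- `l ((τ m − c)^k v) = (χ m − c)^k · l v` for a functional `l` with `l ∘ τ(m) = χ(m) l`. [folklore] -/
theorem functional_apply_pow_sub_smul (χ : M →* ℂˣ) (l : W →ₗ[ℂ] ℂ) (hl : ∀ m v, l (τ m v) = ((χ m : ℂˣ) : ℂ) * l v) (m : M) (c : ℂ) (k : ℕ) (v : W) :
    l (((τ m - c • (1 : Module.End ℂ W)) ^ k) v) = (((χ m : ℂˣ) : ℂ) - c) ^ k * l v := by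
  induction k generalizing v with
  | zero => simp
  | succ k ih =>
    rw [pow_succ, Module.End.mul_apply, ih, pow_succ, mul_assoc]
    congr 1
    simp only [LinearMap.sub_apply, LinearMap.smul_apply, Module.End.one_apply, map_sub, map_smul, hl, smul_eq_mul]
    ring

/-- Such an `l` VANISHES on every weight space of weight `η ≠ χ`. [folklore] -/
theorem functional_eq_zero_of_mem_weightSpace_of_ne (χ : M →* ℂˣ) (l : W →ₗ[ℂ] ℂ) (hl : ∀ m v, l (τ m v) = ((χ m : ℂˣ) : ℂ) * l v)
    {η : M → ℂ} (hη : η ≠ fun m => ((χ m : ℂˣ) : ℂ)) {v : W} (hv : v ∈ ⨅ m, Module.End.maxGenEigenspace (τ m) (η m)) : l v = 0 := by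
  obtain ⟨m, hm⟩ := Function.ne_iff.1 hη
  obtain ⟨k, hk⟩ := (Module.End.mem_maxGenEigenspace _ _ _).1 ((Submodule.mem_iInf _).1 hv m)
  have h := functional_apply_pow_sub_smul τ χ l hl m (η m) k v
  rw [hk, map_zero] at h
  exact (mul_eq_zero.1 h.symm).resolve_left (pow_ne_zero _ (sub_ne_zero.2 (Ne.symm hm)))

/-- **A non-zero `χ`-equivariant functional forces `W_χ ≠ 0`** (finite-dimensional `W`, pairwise commuting action: the weight spaces span ★ E1a, and `l` kills all the
others).  Converse of ★ E1b `exists_functional_of_weightSpace_ne_bot`. [cite: BernsteinZelevinsky1977, §2.3] [cite: Casselman1995, §6.3] -/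
theorem weightSpace_ne_bot_of_functional [FiniteDimensional ℂ W] (hτ : ∀ m m' : M, Commute (τ m) (τ m')) (χ : M →* ℂˣ) (l : W →ₗ[ℂ] ℂ) (hl0 : l ≠ 0)
    (hl : ∀ m v, l (τ m v) = ((χ m : ℂˣ) : ℂ) * l v) : (⨅ m, Module.End.maxGenEigenspace (τ m) ((χ m : ℂˣ) : ℂ)) ≠ ⊥ := by
  intro hbot
  apply hl0
  have hvan : ∀ η : M → ℂ, ∀ v ∈ (⨅ m, Module.End.maxGenEigenspace (τ m) (η m)), l v = 0 := by
    intro η v hv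
    by_cases hη : η = fun m => ((χ m : ℂˣ) : ℂ)
    · subst hη
      rw [hbot, Submodule.mem_bot] at hv
      rw [hv, map_zero]
    · exact functional_eq_zero_of_mem_weightSpace_of_ne τ χ l hl hη hv
  ext v
  have hv : v ∈ ⨆ η : M → ℂ, ⨅ m, Module.End.maxGenEigenspace (τ m) (η m) := by rw [iSup_weightSpace_eq_top τ hτ]; exact Submodule.mem_top
  rw [LinearMap.zero_apply]
  exact Submodule.iSup_induction _ (motive := fun w => l w = 0) hv hvan (map_zero l) fun a b ha hb => by rw [map_add, ha, hb, add_zero]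

end Functional

/-! ## §2 `GL_N`, Borel label: embedding into the principal series attached to a weight -/

section Borel

variable {F : Type*} [Field F] [ValuativeRel F] [TopologicalSpace F] [IsNonarchimedeanLocalField F] {N : ℕ}
  {V : Type*} [AddCommGroup V] [Module ℂ V] (ρ : Representation ℂ (GL (Fin N) F) V)

/-- **EMB: A NON-ZERO WEIGHT EMBEDS INTO THE PRINCIPAL SERIES.**  For `ρ` smooth on `GL_N(F)` with `r_B ρ` finite-dimensional and a character `χ` of the diagonal torus with
`mult ρ ⇑χ ≠ 0`, there is a NON-ZERO intertwining map `Φ : ρ → I(χ) = parabolicIndGL F id (𝟙.twist χ)`: ★ E1b gives a non-zero `T`-equivariant functional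
`r_B ρ → χ`, i.e. a non-zero element of `Hom_T(r̄_B ρ, χ)`, and ★ Frobenius reciprocity `frobenius_reciprocity_gl_holds` turns it into `Φ`.
[cite: BernsteinZelevinsky1977, Prop. 1.9 (b), §2.3] [cite: Casselman1995, Thm. 3.2.4, §6.3] -/
theorem exists_intertwiningMap_parabolicIndGL_ne_zero (hρ : ρ.IsSmooth) [FiniteDimensional ℂ (restrictUnipotentGL F (id : Fin N → Fin N) ρ).Coinvariants]
    (χ : (Π a : Fin N, GL {i : Fin N // (id : Fin N → Fin N) i = a} F) →* ℂˣ)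
    (h : finrank ℂ ↥(⨅ m, Module.End.maxGenEigenspace (normalizedJacquetGL F (id : Fin N → Fin N) ρ m) ((χ m : ℂˣ) : ℂ)) ≠ 0) :
    ∃ Φ : ρ.IntertwiningMap (parabolicIndGL F (id : Fin N → Fin N)
      ((Representation.trivial ℂ (Π a : Fin N, GL {i : Fin N // (id : Fin N → Fin N) i = a} F) ℂ).twist χ)), Φ ≠ 0 := by
  have hne : (⨅ m, Module.End.maxGenEigenspace (normalizedJacquetGL F (id : Fin N → Fin N) ρ m) ((χ m : ℂˣ) : ℂ)) ≠ ⊥ :=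
    fun hb => h (by rw [hb, finrank_bot])
  obtain ⟨l, hl0, hl⟩ := exists_functional_of_weightSpace_ne_bot (normalizedJacquetGL F (id : Fin N → Fin N) ρ)
    (fun m m' => by rw [Commute, SemiconjBy, ← map_mul, levi_id_mul_comm, map_mul]) (fun m => ((χ m : ℂˣ) : ℂ)) hne
  let ψ : (normalizedJacquetGL F (id : Fin N → Fin N) ρ).IntertwiningMap
      ((Representation.trivial ℂ (Π a : Fin N, GL {i : Fin N // (id : Fin N → Fin N) i = a} F) ℂ).twist χ) :=
    ⟨l, fun m => LinearMap.ext fun z => by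
      rw [LinearMap.comp_apply, LinearMap.comp_apply, Representation.twist_apply, Representation.trivial_apply, smul_eq_mul]
      exact hl m z⟩
  obtain ⟨e⟩ := frobenius_reciprocity_gl_holds (V := V) (W := ℂ) F (id : Fin N → Fin N) ρ hρ
    ((Representation.trivial ℂ (Π a : Fin N, GL {i : Fin N // (id : Fin N → Fin N) i = a} F) ℂ).twist χ)
  have hψ : ψ ≠ 0 := fun h0 => by
    have h1 : ψ.toLinearMap = 0 := by rw [h0, Representation.IntertwiningMap.zero_toLinearMap]
    exact hl0 h1
  exact ⟨e.symm ψ, fun h0 => hψ (e.symm.map_eq_zero_iff.1 h0)⟩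

/-- **EMB, IRREDUCIBLE CASE: `ρ ↪ I(χ)`** — for `ρ` irreducible the non-zero `Φ` is injective (Schur, Mathlib `IsIrreducible.injective_or_eq_zero`).
[cite: BernsteinZelevinsky1977, Thm. 2.5] [cite: Casselman1995, §6.3] -/
theorem exists_injective_intertwiningMap_parabolicIndGL [ρ.IsIrreducible] (hρ : ρ.IsSmooth)
    [FiniteDimensional ℂ (restrictUnipotentGL F (id : Fin N → Fin N) ρ).Coinvariants]
    (χ : (Π a : Fin N, GL {i : Fin N // (id : Fin N → Fin N) i = a} F) →* ℂˣ)
    (h : finrank ℂ ↥(⨅ m, Module.End.maxGenEigenspace (normalizedJacquetGL F (id : Fin N → Fin N) ρ m) ((χ m : ℂˣ) : ℂ)) ≠ 0) :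
    ∃ Φ : ρ.IntertwiningMap (parabolicIndGL F (id : Fin N → Fin N)
      ((Representation.trivial ℂ (Π a : Fin N, GL {i : Fin N // (id : Fin N → Fin N) i = a} F) ℂ).twist χ)), Function.Injective Φ := by
  obtain ⟨Φ, hΦ⟩ := exists_intertwiningMap_parabolicIndGL_ne_zero ρ hρ χ h
  exact ⟨Φ, (Representation.IsIrreducible.injective_or_eq_zero Φ).resolve_right hΦ⟩

/-- **CONVERSE: a non-zero `Φ : ρ → I(χ)` forces `mult ρ ⇑χ ≠ 0`** (`ρ` smooth, `r_B ρ` finite-dimensional): Frobenius turns `Φ` into a non-zero `T`-equivariant functional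
`r̄_B ρ → χ`, which detects the `χ`-weight space (§1). [cite: BernsteinZelevinsky1977, Prop. 1.9 (b), §2.3] [cite: Casselman1995, Thm. 3.2.4, §6.3] -/
theorem finrank_weightSpace_ne_zero_of_intertwiningMap_ne_zero (hρ : ρ.IsSmooth) [FiniteDimensional ℂ (restrictUnipotentGL F (id : Fin N → Fin N) ρ).Coinvariants]
    (χ : (Π a : Fin N, GL {i : Fin N // (id : Fin N → Fin N) i = a} F) →* ℂˣ)
    (Φ : ρ.IntertwiningMap (parabolicIndGL F (id : Fin N → Fin N)
      ((Representation.trivial ℂ (Π a : Fin N, GL {i : Fin N // (id : Fin N → Fin N) i = a} F) ℂ).twist χ))) (hΦ : Φ ≠ 0) :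
    finrank ℂ ↥(⨅ m, Module.End.maxGenEigenspace (normalizedJacquetGL F (id : Fin N → Fin N) ρ m) ((χ m : ℂˣ) : ℂ)) ≠ 0 := by
  obtain ⟨e⟩ := frobenius_reciprocity_gl_holds (V := V) (W := ℂ) F (id : Fin N → Fin N) ρ hρ
    ((Representation.trivial ℂ (Π a : Fin N, GL {i : Fin N // (id : Fin N → Fin N) i = a} F) ℂ).twist χ)
  set ψ : (normalizedJacquetGL F (id : Fin N → Fin N) ρ).IntertwiningMap
      ((Representation.trivial ℂ (Π a : Fin N, GL {i : Fin N // (id : Fin N → Fin N) i = a} F) ℂ).twist χ) := e Φ with hψdef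
  have hψ : ψ ≠ 0 := fun h0 => hΦ (e.map_eq_zero_iff.1 h0)
  have hl0 : ψ.toLinearMap ≠ 0 := fun h0 =>
    hψ (Representation.IntertwiningMap.toLinearMap_injective _ _ (h0.trans (Representation.IntertwiningMap.zero_toLinearMap _ _).symm))
  have hl : ∀ m x, ψ.toLinearMap (normalizedJacquetGL F (id : Fin N → Fin N) ρ m x) = ((χ m : ℂˣ) : ℂ) * ψ.toLinearMap x := fun m x => by
    have h1 := Representation.IntertwiningMap.isIntertwining _ _ ψ m x
    rw [Representation.twist_apply, Representation.trivial_apply, smul_eq_mul] at h1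
    exact h1
  have hne := weightSpace_ne_bot_of_functional (normalizedJacquetGL F (id : Fin N → Fin N) ρ)
    (fun m m' => by rw [Commute, SemiconjBy, ← map_mul, levi_id_mul_comm, map_mul]) χ ψ.toLinearMap hl0 hl
  exact fun h0 => hne (Submodule.finrank_eq_zero.1 h0)

/-- **`mult ρ ⇑χ ≠ 0 ↔ Hom(ρ, I(χ)) ≠ 0`** for `ρ` smooth with `r_B ρ` finite-dimensional. [cite: BernsteinZelevinsky1977, Prop. 1.9 (b), §2.3] -/
theorem finrank_weightSpace_ne_zero_iff_exists_intertwiningMap (hρ : ρ.IsSmooth) [FiniteDimensional ℂ (restrictUnipotentGL F (id : Fin N → Fin N) ρ).Coinvariants]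
    (χ : (Π a : Fin N, GL {i : Fin N // (id : Fin N → Fin N) i = a} F) →* ℂˣ) :
    finrank ℂ ↥(⨅ m, Module.End.maxGenEigenspace (normalizedJacquetGL F (id : Fin N → Fin N) ρ m) ((χ m : ℂˣ) : ℂ)) ≠ 0 ↔
      ∃ Φ : ρ.IntertwiningMap (parabolicIndGL F (id : Fin N → Fin N)
        ((Representation.trivial ℂ (Π a : Fin N, GL {i : Fin N // (id : Fin N → Fin N) i = a} F) ℂ).twist χ)), Φ ≠ 0 :=
  ⟨exists_intertwiningMap_parabolicIndGL_ne_zero ρ hρ χ, fun ⟨Φ, hΦ⟩ => finrank_weightSpace_ne_zero_of_intertwiningMap_ne_zero ρ hρ χ Φ hΦ⟩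

/-- **For `ρ` irreducible: `mult ρ ⇑χ ≠ 0 ↔ ρ ↪ I(χ)`.** [cite: BernsteinZelevinsky1977, Thm. 2.5] [cite: Casselman1995, §6.3] -/
theorem finrank_weightSpace_ne_zero_iff_exists_injective [ρ.IsIrreducible] (hρ : ρ.IsSmooth)
    [FiniteDimensional ℂ (restrictUnipotentGL F (id : Fin N → Fin N) ρ).Coinvariants]
    (χ : (Π a : Fin N, GL {i : Fin N // (id : Fin N → Fin N) i = a} F) →* ℂˣ) :
    finrank ℂ ↥(⨅ m, Module.End.maxGenEigenspace (normalizedJacquetGL F (id : Fin N → Fin N) ρ m) ((χ m : ℂˣ) : ℂ)) ≠ 0 ↔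
      ∃ Φ : ρ.IntertwiningMap (parabolicIndGL F (id : Fin N → Fin N)
        ((Representation.trivial ℂ (Π a : Fin N, GL {i : Fin N // (id : Fin N → Fin N) i = a} F) ℂ).twist χ)), Function.Injective Φ := by
  haveI : Nontrivial V := Representation.IsIrreducible.nontrivial ρ
  refine ⟨exists_injective_intertwiningMap_parabolicIndGL ρ hρ χ, fun ⟨Φ, hΦ⟩ => ?_⟩
  refine finrank_weightSpace_ne_zero_of_intertwiningMap_ne_zero ρ hρ χ Φ fun h0 => ?_
  obtain ⟨v, hv⟩ := exists_ne (0 : V)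
  exact hv (hΦ (by rw [h0, map_zero]; rfl))

end Borel

end Summit.HodgeConjecture.HodgeConjecture.Cruxes.H413.K2E3GL3EmbeddingOfWeight

end
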